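import Summits.AtomisticToContinuum.FouriersLaw.Theorems.LocalOhmBVLocalOhmStubWindowEnergyCovarianceWeakAux2

/-!
# Stub `stub_windowEnergyCovarianceWeak_of_termDecay` (T1) of the birth line of crux `LocalOhmBV.LocalOhm`

Crux item stmt-AtomisticToContinuum-12009 (`Summit.AtomisticToContinuum.FouriersLaw.Theses.LocalOhmBV.LocalOhm`),
line `registered` (birth; reshaped by lead c4: S2b♭ replaced by T1/T2). This file proves T1: FROM the per-term
exponential decay T2 (`stub_gibbsTermCovarianceDecay`, taken verbatim as a hypothesis) — for a window observable
`G = g ∘ boxRestrictAt a n ∘ embed N c` of the free finite-volume Gibbs state `μ_{N,T}` of `pinnedChain ω₂ lam β γ`,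
`|Cov_{μ_{N,T}}(G, U(q_t))|, |Cov_{μ_{N,T}}(G, V(q_{t+1} - q_t))| ≤ C r^d` for terms at distance `d` to the RIGHT of
the window — TO the per-observable `N`-uniform window–energy covariance bound
`|Cov_{μ_{N,T}}(G, H_N)| ≤ B(g)` for all `N` and all windows inside `[0, N)`.

Proof. `H_N = Σ_t p_t²/2 + Σ_t U(q_t) + Σ_t Σ_{t'} [t' = t+1] V(q_{t'} - q_t)` and the covariance is split term
by term (`cov_hamiltonian_eq_sum`; every product is integrable, `G` and the one-site energies being continuous of
polynomial growth). Kinetic terms: zero off the window (`cov_kinetic_eq_zero`, Gaussian integration by parts in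
`p_t`), bounded on it (Cauchy–Schwarz with `N`-uniform window second moments, `abs_cov_kinetic_le`). Potential
terms: to the right of the window by T2 (a geometric series), on / next to the window by Cauchy–Schwarz
(`abs_cov_U_le`, `abs_cov_V_le`), to the left of the window by T2 applied to the REFLECTED window observable
(profile `g ∘ rev`, same polynomial bound) — the site reflection preserves `μ_{N,T}` and maps left terms to right
terms of the reflected window (`cov_U_siteReflection`, `cov_V_siteReflection`). The bookkeeping is
`abs_cov_sum_le` (helpers II).
-/

set_option autoImplicit false

noncomputable section

namespace Summit.AtomisticToContinuum.FouriersLaw.Theorems.LocalOhmBirth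

open MeasureTheory Filter Topology
open scoped BigOperators
open Literature.MathematicalPhysics.KineticTheory Literature.MathematicalPhysics.KineticTheory.HeatConduction
open Summit.AtomisticToContinuum.FouriersLaw.Theorems.WindowLimit (embed)
open Summit.AtomisticToContinuum.FouriersLaw.Theorems.LocalOhmBirth.SoftExtraction
  (polyBound_comp_boxRestrictAt_embed continuous_comp_boxRestrictAt_embed)
open Summit.AtomisticToContinuum.FouriersLaw.Theorems.LocalOhmBirth.WindowEnergyCovariance

namespace WindowEnergyCovariance

/-! ### Term-by-term splitting of `Cov(F, H_N)` -/

/-- The algebra of the splitting: `(Σ A + ΣΣ[·] C) - m (Σ a + ΣΣ[·] c) = Σ (A - m a) + ΣΣ[·] (C - m c)` (two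
families `A, B` in the single sum). [folklore] -/
theorem cov_sum_algebra {N : ℕ} (m : ℝ) (A a B b : Fin N → ℝ) (C c : Fin N → Fin N → ℝ) :
    ((∑ i : Fin N, (A i + B i)) + ∑ i : Fin N, ∑ j : Fin N, (if j.val = i.val + 1 then C i j else 0)) -
        m * ((∑ i : Fin N, (a i + b i)) + ∑ i : Fin N, ∑ j : Fin N, (if j.val = i.val + 1 then c i j else 0)) =
      (∑ i : Fin N, ((A i - m * a i) + (B i - m * b i))) +
        ∑ i : Fin N, ∑ j : Fin N, (if j.val = i.val + 1 then C i j - m * c i j else 0) := by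
  have h1 : ∀ i ∈ (Finset.univ : Finset (Fin N)), (A i - m * a i) + (B i - m * b i) =
      (A i + B i) - m * (a i + b i) := fun i _ => by ring
  have h2 : ∀ i ∈ (Finset.univ : Finset (Fin N)), ∑ j : Fin N, (if j.val = i.val + 1 then C i j - m * c i j else 0) =
      (∑ j : Fin N, (if j.val = i.val + 1 then C i j else 0)) -
        m * ∑ j : Fin N, (if j.val = i.val + 1 then c i j else 0) := fun i _ => by
    rw [Finset.mul_sum, ← Finset.sum_sub_distrib]
    refine Finset.sum_congr rfl fun j _ => ?_
    split_ifs <;> ring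
  rw [Finset.sum_congr rfl h1, Finset.sum_congr rfl h2, Finset.sum_sub_distrib, Finset.sum_sub_distrib,
    ← Finset.mul_sum, ← Finset.mul_sum]
  ring

variable {ω₂ lam β : ℝ}

/-- **`∫ F H_N dμ_{N,T}` term by term** for continuous `F` of polynomial growth (every `F · (one-site energy)` is
integrable under the Gibbs state of the pinned chain). [folklore] -/
theorem integral_mul_hamiltonian_eq_sum (γ : ℝ) (hω : 0 < ω₂) (hl : 0 ≤ lam) (hβ : 0 ≤ β) {T : ℝ} (hT : 0 < T)
    {N : ℕ} {F : PhaseSpace N → ℝ} (hF : Continuous F)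
    (hFb : ∃ (C₀ : ℝ) (m : ℕ), ∀ z, |F z| ≤ C₀ * (1 + ‖z‖) ^ m) :
    ∫ z, F z * (pinnedChain ω₂ lam β γ).hamiltonian N z ∂((pinnedChain ω₂ lam β γ).gibbsMeasure N T) =
      (∑ i : Fin N, ((∫ z, F z * (z.2 i ^ 2 / 2) ∂((pinnedChain ω₂ lam β γ).gibbsMeasure N T)) +
          ∫ z, F z * (pinnedChain ω₂ lam β γ).U (z.1 i) ∂((pinnedChain ω₂ lam β γ).gibbsMeasure N T))) +
        ∑ i : Fin N, ∑ j : Fin N, (if j.val = i.val + 1 then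
          ∫ z, F z * (pinnedChain ω₂ lam β γ).V (z.1 j - z.1 i) ∂((pinnedChain ω₂ lam β γ).gibbsMeasure N T)
          else 0) := by
  set P := pinnedChain ω₂ lam β γ with hP
  set μ := P.gibbsMeasure N T with hμ
  have hint : ∀ {ψ : PhaseSpace N → ℝ}, Continuous ψ →
      (∃ (C : ℝ) (k : ℕ), ∀ z, |ψ z| ≤ C * (1 + ‖z‖) ^ k) → Integrable (fun z => F z * ψ z) μ := by
    intro ψ hψ hb
    obtain ⟨C, k, h⟩ := polyBound_mul hFb hb
    exact integrable_gibbsMeasure_of_polyBound hω hl hβ γ N hT (hF.mul hψ) h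
  have bk : ∀ (i : Fin N) (z : PhaseSpace N), |z.2 i ^ 2 / 2| ≤ 1 * (1 + ‖z‖) ^ 2 := fun i z => by
    have h := polyBound_comp_boxRestrictAt_embed (N := N) (c := 0) ((i.val : ℕ) : ℤ) 0 (kinetic_profile 0).2 z
    simpa only [boxRestrictAt_embed_site_zero i (show i.val + 0 < N by omega)] using h
  have bU : ∀ (i : Fin N) (z : PhaseSpace N), |P.U (z.1 i)| ≤ (ω₂ / 2 + lam / 4) * (1 + ‖z‖) ^ 4 := fun i z => by
    have h := polyBound_comp_boxRestrictAt_embed (N := N) (c := 0) ((i.val : ℕ) : ℤ) 0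
      (pinnedChain_U_profile (β := β) γ hω.le hl 0).2 z
    simpa only [boxRestrictAt_embed_site_zero i (show i.val + 0 < N by omega)] using h
  have bV : ∀ i j : Fin N, j.val = i.val + 1 → ∀ z : PhaseSpace N,
      |P.V (z.1 j - z.1 i)| ≤ (2 + 4 * β) * (1 + ‖z‖) ^ 4 := fun i j hj z => by
    have h := polyBound_comp_boxRestrictAt_embed (N := N) (c := 0) ((i.val : ℕ) : ℤ) 1
      (pinnedChain_V_profile γ hβ ω₂ lam).2 z
    simpa only [boxRestrictAt_embed_site_zero i (show i.val + 1 < N by omega),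
      boxRestrictAt_embed_site_one i j hj] using h
  have cU : ∀ i : Fin N, Continuous fun z : PhaseSpace N => P.U (z.1 i) := fun i =>
    (pinnedChain_contDiff_U ω₂ lam β γ (n := 0)).continuous.comp ((continuous_apply i).comp continuous_fst)
  have cV : ∀ i j : Fin N, Continuous fun z : PhaseSpace N => P.V (z.1 j - z.1 i) := fun i j =>
    (pinnedChain_contDiff_V ω₂ lam β γ (n := 0)).continuous.comp
      (((continuous_apply j).comp continuous_fst).sub ((continuous_apply i).comp continuous_fst))
  have iK : ∀ i : Fin N, Integrable (fun z => F z * (z.2 i ^ 2 / 2)) μ := fun i =>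
    hint (by fun_prop) ⟨1, 2, bk i⟩
  have iU : ∀ i : Fin N, Integrable (fun z => F z * P.U (z.1 i)) μ := fun i => hint (cU i) ⟨_, 4, bU i⟩
  have iKU : ∀ i : Fin N, Integrable (fun z => F z * (z.2 i ^ 2 / 2) + F z * P.U (z.1 i)) μ := fun i =>
    (iK i).add (iU i)
  have iV : ∀ i j : Fin N,
      Integrable (fun z => if j.val = i.val + 1 then F z * P.V (z.1 j - z.1 i) else 0) μ := by
    intro i j
    by_cases hj : j.val = i.val + 1
    · simp only [if_pos hj]
      exact hint (cV i j) ⟨_, 4, bV i j hj⟩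
    · simp only [if_neg hj]
      exact integrable_zero _ _ _
  have iVs : ∀ i : Fin N,
      Integrable (fun z => ∑ j : Fin N, (if j.val = i.val + 1 then F z * P.V (z.1 j - z.1 i) else 0)) μ :=
    fun i => integrable_finsetSum _ fun j _ => iV i j
  have hpt : ∀ z, F z * P.hamiltonian N z =
      (∑ i : Fin N, (F z * (z.2 i ^ 2 / 2) + F z * P.U (z.1 i))) +
        ∑ i : Fin N, ∑ j : Fin N, (if j.val = i.val + 1 then F z * P.V (z.1 j - z.1 i) else 0) := fun z => by
    simp only [OscillatorChain.hamiltonian, mul_add, Finset.mul_sum, mul_ite, mul_zero]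
  simp_rw [hpt]
  rw [integral_add (integrable_finsetSum _ fun i _ => iKU i) (integrable_finsetSum _ fun i _ => iVs i),
    integral_finsetSum _ fun i _ => iKU i, integral_finsetSum _ fun i _ => iVs i]
  congr 1
  · exact Finset.sum_congr rfl fun i _ => integral_add (iK i) (iU i)
  · refine Finset.sum_congr rfl fun i _ => ?_
    rw [integral_finsetSum _ fun j _ => iV i j]
    refine Finset.sum_congr rfl fun j _ => ?_
    by_cases hj : j.val = i.val + 1
    · simp only [if_pos hj]
    · simp only [if_neg hj, integral_zero]

/-- **`Cov_{μ_{N,T}}(F, H_N)` term by term** for continuous `F` of polynomial growth. [folklore] -/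
theorem cov_hamiltonian_eq_sum (γ : ℝ) (hω : 0 < ω₂) (hl : 0 ≤ lam) (hβ : 0 ≤ β) {T : ℝ} (hT : 0 < T)
    {N : ℕ} {F : PhaseSpace N → ℝ} (hF : Continuous F)
    (hFb : ∃ (C₀ : ℝ) (m : ℕ), ∀ z, |F z| ≤ C₀ * (1 + ‖z‖) ^ m) :
    (∫ z, F z * (pinnedChain ω₂ lam β γ).hamiltonian N z ∂((pinnedChain ω₂ lam β γ).gibbsMeasure N T)) -
        (∫ z, F z ∂((pinnedChain ω₂ lam β γ).gibbsMeasure N T)) *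
          (∫ z, (pinnedChain ω₂ lam β γ).hamiltonian N z ∂((pinnedChain ω₂ lam β γ).gibbsMeasure N T)) =
      (∑ i : Fin N,
        (((∫ z, F z * (z.2 i ^ 2 / 2) ∂((pinnedChain ω₂ lam β γ).gibbsMeasure N T)) -
            (∫ z, F z ∂((pinnedChain ω₂ lam β γ).gibbsMeasure N T)) *
              (∫ z, z.2 i ^ 2 / 2 ∂((pinnedChain ω₂ lam β γ).gibbsMeasure N T))) +
          ((∫ z, F z * (pinnedChain ω₂ lam β γ).U (z.1 i) ∂((pinnedChain ω₂ lam β γ).gibbsMeasure N T)) -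
            (∫ z, F z ∂((pinnedChain ω₂ lam β γ).gibbsMeasure N T)) *
              (∫ z, (pinnedChain ω₂ lam β γ).U (z.1 i) ∂((pinnedChain ω₂ lam β γ).gibbsMeasure N T))))) +
      ∑ i : Fin N, ∑ j : Fin N, (if j.val = i.val + 1 then
        (∫ z, F z * (pinnedChain ω₂ lam β γ).V (z.1 j - z.1 i) ∂((pinnedChain ω₂ lam β γ).gibbsMeasure N T)) -
          (∫ z, F z ∂((pinnedChain ω₂ lam β γ).gibbsMeasure N T)) *
            (∫ z, (pinnedChain ω₂ lam β γ).V (z.1 j - z.1 i) ∂((pinnedChain ω₂ lam β γ).gibbsMeasure N T))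
        else 0) := by
  have h1 := integral_mul_hamiltonian_eq_sum γ hω hl hβ hT hF hFb
  have h2 := integral_mul_hamiltonian_eq_sum (ω₂ := ω₂) (lam := lam) (β := β) γ hω hl hβ hT (N := N)
    (F := fun _ => (1 : ℝ)) continuous_const ⟨1, 0, fun z => by simp⟩
  simp only [one_mul] at h2
  rw [h1, h2]
  exact cov_sum_algebra _ _ _ _ _ _ _

end WindowEnergyCovariance

/-- **T1 `stub_windowEnergyCovarianceWeak_of_termDecay`** (RESHAPE c4 of S2b♭ of the birth line of
`LocalOhmBV.LocalOhm`). From the per-term decay T2 (taken as a hypothesis, verbatim) to the PER-OBSERVABLE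
`N`-uniform window–energy covariance bound: for every window size `n` and every continuous polynomially bounded `g`
there is `B` (depending on the parameters, `T`, `n`, `g` — NOT on `N` or the window position) with
`|Cov_{Gibbs_N}(g ∘ boxRestrictAt a n ∘ embed N c, H_N)| ≤ B` for all `N` and all windows `{a+c, …, a+c+n} ⊆ [0, N)`.
Route: `H_N = Σ_i p_i²/2 + Σ_i U(q_i) + Σ_bonds V`; kinetic terms outside the window have ZERO covariance with `G`
(Gaussian integration by parts in `p_i`), inside the window Cauchy–Schwarz with `N`-uniform window moments;
potential terms to the right of the window by T2 (geometric series `Σ_d C r^d`), to the left by T2 applied to the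
REFLECTED chain `i ↦ N-1-i` (which preserves `gibbsMeasure N T`, `V` even, and maps `g ∘ boxRestrictAt a n ∘ embed N c`
to `g' ∘ boxRestrictAt a' n ∘ embed N 0`, `g' = g ∘ rev`, `a' = N-1-(a+c)-n`), terms on / next to the window by
Cauchy–Schwarz. [folklore] -/
theorem stub_windowEnergyCovarianceWeak_of_termDecay :
    (∀ ω₂ lam β γ : ℝ, 0 < ω₂ → 0 < lam → 0 < β → 0 < γ → ∀ T : ℝ, 0 < T →
    ∀ (n : ℕ) (g : (Fin (n + 1) → ℝ × ℝ) → ℝ), Continuous g →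
    (∃ (C₀ : ℝ) (m : ℕ), ∀ y, |g y| ≤ C₀ * (1 + ‖y‖) ^ m) →
    ∃ (C r : ℝ), 0 ≤ C ∧ 0 ≤ r ∧ r < 1 ∧
      ∀ (N c : ℕ) (a : ℤ), 0 ≤ a + c → a + c + n < N →
      ∀ (t : Fin N) (d : ℕ), a + c + n + d ≤ (t.val : ℤ) →
        |(∫ z, g (boxRestrictAt a n (embed N c z)) * (pinnedChain ω₂ lam β γ).U (z.1 t) ∂((pinnedChain ω₂ lam β γ).gibbsMeasure N T)) -
            (∫ z, g (boxRestrictAt a n (embed N c z)) ∂((pinnedChain ω₂ lam β γ).gibbsMeasure N T)) * (∫ z, (pinnedChain ω₂ lam β γ).U (z.1 t) ∂((pinnedChain ω₂ lam β γ).gibbsMeasure N T))| ≤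
          C * r ^ d ∧
        ∀ t' : Fin N, t'.val = t.val + 1 →
        |(∫ z, g (boxRestrictAt a n (embed N c z)) * (pinnedChain ω₂ lam β γ).V (z.1 t' - z.1 t) ∂((pinnedChain ω₂ lam β γ).gibbsMeasure N T)) -
            (∫ z, g (boxRestrictAt a n (embed N c z)) ∂((pinnedChain ω₂ lam β γ).gibbsMeasure N T)) * (∫ z, (pinnedChain ω₂ lam β γ).V (z.1 t' - z.1 t) ∂((pinnedChain ω₂ lam β γ).gibbsMeasure N T))| ≤
          C * r ^ d) →
    ∀ ω₂ lam β γ : ℝ, 0 < ω₂ → 0 < lam → 0 < β → 0 < γ → ∀ T : ℝ, 0 < T →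
    ∀ (n : ℕ) (g : (Fin (n + 1) → ℝ × ℝ) → ℝ), Continuous g →
    (∃ (C₀ : ℝ) (m : ℕ), ∀ y, |g y| ≤ C₀ * (1 + ‖y‖) ^ m) →
    ∃ B : ℝ, ∀ (N c : ℕ) (a : ℤ), 0 ≤ a + c → a + c + n < N →
      |(∫ z, g (boxRestrictAt a n (embed N c z)) * (pinnedChain ω₂ lam β γ).hamiltonian N z ∂((pinnedChain ω₂ lam β γ).gibbsMeasure N T)) -
          (∫ z, g (boxRestrictAt a n (embed N c z)) ∂((pinnedChain ω₂ lam β γ).gibbsMeasure N T)) * (∫ z, (pinnedChain ω₂ lam β γ).hamiltonian N z ∂((pinnedChain ω₂ lam β γ).gibbsMeasure N T))| ≤ B := by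
  intro hT2 ω₂ lam β γ hω hl hβ hγ T hT n g hg hb
  obtain ⟨C₀, m, hle⟩ := hb
  -- the reversed profile, same regularity
  have hg'c : Continuous fun y : Fin (n + 1) → ℝ × ℝ => g (fun i => y (Fin.rev i)) :=
    hg.comp (continuous_pi fun i => continuous_apply _)
  have hle' : ∀ y : Fin (n + 1) → ℝ × ℝ, |g (fun i => y (Fin.rev i))| ≤ C₀ * (1 + ‖y‖) ^ m := by
    intro y
    have hC0 : 0 ≤ C₀ := by
      have h := hle 0
      rw [norm_zero, add_zero, one_pow, mul_one] at h
      exact (abs_nonneg _).trans h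
    have hn : ‖(fun i => y (Fin.rev i))‖ ≤ ‖y‖ :=
      (pi_norm_le_iff_of_nonneg (norm_nonneg y)).2 fun i => norm_le_pi_norm y _
    exact (hle _).trans (mul_le_mul_of_nonneg_left (pow_le_pow_left₀ (by positivity) (by linarith) m) hC0)
  -- the two decay instances (original and reflected profile) and the three Cauchy–Schwarz constants
  obtain ⟨C, r, hC, hr0, hr1, hR⟩ := hT2 ω₂ lam β γ hω hl hβ hγ T hT n g hg ⟨C₀, m, hle⟩
  obtain ⟨C', r', hC', hr0', hr1', hL⟩ := hT2 ω₂ lam β γ hω hl hβ hγ T hT n _ hg'c ⟨C₀, m, hle'⟩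
  obtain ⟨Kk, -, hKk⟩ := abs_cov_kinetic_le γ hω hl.le hβ.le hT n hg hle
  obtain ⟨KU, -, hKU⟩ := abs_cov_U_le γ hω hl.le hβ.le hT n hg hle
  obtain ⟨KV, hKV0, hKV⟩ := abs_cov_V_le γ hω hl.le hβ.le hT n hg hle
  refine ⟨(n + 1) * Kk + (C' / (1 - r') + n * KU + C / (1 - r)) + (C' / (1 - r') + n * KV + C / (1 - r)),
    fun N c a h0 hN => ?_⟩
  obtain ⟨e, he⟩ : ∃ e : ℕ, (e : ℤ) = a + c := ⟨(a + c).toNat, by omega⟩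
  have h0' : (0 : ℤ) ≤ ((N : ℤ) - 1 - (a + c) - n) + ((0 : ℕ) : ℤ) := by push_cast; omega
  have hN' : ((N : ℤ) - 1 - (a + c) - n) + ((0 : ℕ) : ℤ) + n < N := by push_cast; omega
  have hRs := hR N c a h0 hN
  have hLs := hL N 0 ((N : ℤ) - 1 - (a + c) - n) h0' hN'
  rw [cov_hamiltonian_eq_sum γ hω hl.le hβ.le hT (continuous_comp_boxRestrictAt_embed a n hg)
    ⟨C₀, m, fun z => polyBound_comp_boxRestrictAt_embed a n hle z⟩]
  refine abs_cov_sum_le (e := e) (n := n) (by omega) _ _ _ hKV0 hC hr0 hr1 hC' hr0' hr1'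
    (fun t ht => ?_) (fun t => hKk N c a h0 hN t) (fun t ht => ?_) (fun t => hKU N c a h0 hN t)
    (fun t ht => ?_) (fun t t' htt' ht => ?_) (fun t t' htt' => hKV N c a h0 hN t t' htt')
    (fun t t' htt' ht => ?_)
  · -- kinetic, off the window
    exact cov_kinetic_eq_zero γ hω hl.le hβ.le hT hg hle h0 hN t (by omega)
  · -- pinning, left of the window: reflect
    have hrv : (Fin.rev t).val = N - (t.val + 1) := Fin.val_rev t
    have hd : ((N : ℤ) - 1 - (a + c) - n) + ((0 : ℕ) : ℤ) + n + ((e - 1 - t.val : ℕ) : ℤ) ≤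
        ((Fin.rev t).val : ℤ) := by push_cast; omega
    exact (congrArg abs (cov_U_siteReflection ω₂ lam β γ T g h0 hN t)).trans_le
      (hLs (Fin.rev t) (e - 1 - t.val) hd).1
  · -- pinning, right of the window
    have hd : a + c + n + ((t.val - (e + n) : ℕ) : ℤ) ≤ (t.val : ℤ) := by omega
    exact (hRs t (t.val - (e + n)) hd).1
  · -- bond, left of the window: reflect
    have hrv : (Fin.rev t).val = N - (t.val + 1) := Fin.val_rev t
    have hrv' : (Fin.rev t').val = N - (t'.val + 1) := Fin.val_rev t'
    have hd : ((N : ℤ) - 1 - (a + c) - n) + ((0 : ℕ) : ℤ) + n + ((e - 1 - t.val : ℕ) : ℤ) ≤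
        ((Fin.rev t').val : ℤ) := by push_cast; omega
    have hs : (Fin.rev t).val = (Fin.rev t').val + 1 := by omega
    exact (congrArg abs (cov_V_siteReflection ω₂ lam β γ T g h0 hN t t')).trans_le
      ((hLs (Fin.rev t') (e - 1 - t.val) hd).2 (Fin.rev t) hs)
  · -- bond, right of the window
    have hd : a + c + n + ((t.val - (e + n) : ℕ) : ℤ) ≤ (t.val : ℤ) := by omega
    exact (hRs t (t.val - (e + n)) hd).2 t' htt'

end Summit.AtomisticToContinuum.FouriersLaw.Theorems.LocalOhmBirth

end
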